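import Literature.AlgebraicGeometry.HodgeTheory.SymbolClasses
import Literature.NumberTheory.Transcendental.KaehlerDDbarLemmaProofs
import Literature.NumberTheory.Transcendental.DolbeaultProofs
import Literature.NumberTheory.Transcendental.DolbeaultIntegrabilityProofs
import Literature.NumberTheory.Transcendental.ComplexFormsProofs
import Literature.NumberTheory.Transcendental.ComplexFormsSmoothProofs
import Literature.Geometry.Kaehler.CechDeRhamTransgression
import Literature.Algebra.Homology.DoubleComplexExactRows
import Mathlib.Geometry.Manifold.PartitionOfUnity
import Literature.Geometry.Kaehler.LocalPQForms
import Literature.Geometry.Kaehler.HolomorphicFunctionsDolbeault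
import Literature.Analysis.Complex.PQTypes
import Literature.Analysis.Complex.PQTypesWedgeVanishing

/-!
# Stub (T) of the line `NashDescentSketch`, helper 1/3: strictness of the Hodge filtration on forms; pointwise types of symbol forms

Helper file (crux `SymbolClassesAlgebraic`, stmt-HodgeConjecture-17743; registered sub-goal
`stub_symbolClassesHodgeType_dlogType`, serving the stub `stub_symbolClassesHodgeType`).
(a) On a compact Kähler manifold a closed smooth complex `k`-form all of whose type components
`(P, Q)`, `P < p`, vanish has its de Rham class in `F^p H^k = ⨆_{P ≥ p} H^{P,Q}` (Voisin I,
Prop. 7.5), proved by descending `p` with the `∂∂̄`-lemma (Voisin I, Prop. 6.17; tree: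
`ddbar_of_dolbeaultBar`). (b) The symbol forms `Σ n · dlog f₁ ∧ ⋯ ∧ dlog f_p` of chains of
holomorphic units on an open `W` are of type `(p, 0)` at the points of `W`. Everything is proved; no
named fact is introduced.
-/

noncomputable section

open scoped Manifold Topology ContDiff
open CategoryTheory AlgebraicGeometry Filter

-- the tree's own summit-side namespaces repeat `HodgeConjecture` (summit = sub-problem)
set_option linter.dupNamespace false

-- `TangentSpace 𝓘(ℝ, E) x = E` is an abuse of definitional equality; let `isDefEq` unfold it.
set_option backward.isDefEq.respectTransparency false

namespace Summit.HodgeConjecture.HodgeConjecture.Theorems.MilnorKExponentialNash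

open Literature.AlgebraicGeometry Literature.AlgebraicGeometry.HodgeTheory
  Literature.AlgebraicGeometry.Motives Literature.Geometry.Kaehler
  Literature.NumberTheory.Transcendental

/-! ### Strictness: a closed form of `F^p A^k` has its class in `F^p H^k` (compact Kähler) -/

section Strictness

variable {E : Type*} [NormedAddCommGroup E] [NormedSpace ℂ E]
  {M : Type*} [TopologicalSpace M] [ChartedSpace E M]

/-- `d(-α) = -dα` (no smoothness needed). [folklore] -/
theorem mextDeriv_neg'' {k : ℕ} (α : MForm 𝓘(ℝ, E) M ℂ k) : mextDeriv (-α) = -mextDeriv α := by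
  rw [← neg_one_smul ℝ α, mextDeriv_smul, neg_one_smul]

/-- `d(α - β) = dα - dβ` for smooth forms. [folklore] -/
theorem mextDeriv_sub'' [IsManifold 𝓘(ℝ, E) ∞ M] {k : ℕ} {α β : MForm 𝓘(ℝ, E) M ℂ k}
    (hα : IsSmoothForm α) (hβ : IsSmoothForm β) : mextDeriv (α - β) = mextDeriv α - mextDeriv β := by
  rw [sub_eq_add_neg, mextDeriv_add hα hβ.neg', mextDeriv_neg'', ← sub_eq_add_neg]

/-- A `k`-form all of whose type components `α^{P,Q}` with `P < p` vanish, for some `p > k`, is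
zero (type decomposition `α = Σ_{P+Q=k} α^{P,Q}`). [cite: VoisinHodgeI2002, §2.3.1] -/
theorem eq_zero_of_typeComponent_eq_zero_of_lt {k p : ℕ} (hk : k < p) {ζ : MForm 𝓘(ℝ, E) M ℂ k}
    (hF : ∀ P Q : ℕ, P < p → ζ.typeComponent P Q = 0) : ζ = 0 := by
  rw [← sum_antidiagonal_typeComponent_holds ζ]
  refine Finset.sum_eq_zero fun pq hpq ↦ hF pq.1 pq.2 ?_
  have := Finset.HasAntidiagonal.mem_antidiagonal.1 hpq
  omega

/-- A `k`-form all of whose type components `α^{P,Q}` with `P < k` vanish is of type `(k, 0)`.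
[cite: VoisinHodgeI2002, §2.3.1] -/
theorem isOfType_zero_of_typeComponent_eq_zero {k : ℕ} {ζ : MForm 𝓘(ℝ, E) M ℂ k}
    (hF : ∀ P Q : ℕ, P < k → ζ.typeComponent P Q = 0) : IsOfType k 0 ζ := by
  rw [isOfType_iff_typeComponent_eq_self_holds (Nat.add_zero k) ζ]
  conv_rhs => rw [← sum_antidiagonal_typeComponent_holds ζ]
  rw [Finset.sum_eq_single (k, 0)]
  · intro pq hpq hne
    refine hF pq.1 pq.2 ?_
    have h := Finset.HasAntidiagonal.mem_antidiagonal.1 hpq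
    rcases Nat.lt_or_ge pq.1 k with hlt | hge
    · exact hlt
    · exfalso
      apply hne
      have h1 : pq.1 = k := by omega
      have h2 : pq.2 = 0 := by omega
      exact Prod.ext h1 h2
  · intro h
    exact absurd (Finset.HasAntidiagonal.mem_antidiagonal.2 (Nat.add_zero k)) h

variable [IsManifold 𝓘(ℂ, E) ω M] [IsManifold 𝓘(ℝ, E) ∞ M]

/-- **The lowest type component of a closed form of `F^p` is `∂̄`-closed**: if `dζ = 0` and
`ζ^{P,Q} = 0` for `P < p`, then `∂̄ ζ^{p,Q} = (dζ)^{p,Q+1} = 0` (only `ζ^{p,Q}` contributes to the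
`(p, Q+1)`-component of `dζ = Σ d ζ^{P,Q'}`, by `d A^{P,Q'} ⊆ A^{P+1,Q'} ⊕ A^{P,Q'+1}`).
[cite: VoisinHodgeI2002, §2.3.1 and Prop. 7.5] -/
theorem dolbeaultBar_typeComponent_eq_zero {k p Q : ℕ} (hpQ : p + Q = k)
    {ζ : MForm 𝓘(ℝ, E) M ℂ k} (hζ : IsSmoothForm ζ) (hd : mextDeriv ζ = 0)
    (hF : ∀ P Q' : ℕ, P < p → ζ.typeComponent P Q' = 0) :
    dolbeaultBar (ζ.typeComponent p Q) = 0 := by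
  have ha : IsOfType p Q (ζ.typeComponent p Q) := isOfType_typeComponent_holds hpQ ζ
  rw [IsOfType.dolbeaultBar_eq_holds ha]
  have hsm : ∀ pq ∈ Finset.HasAntidiagonal.antidiagonal k,
      IsSmoothForm (ζ.typeComponent pq.1 pq.2) := fun pq _ ↦ hζ.typeComponent _ _
  have key : (mextDeriv ζ).typeComponent p (Q + 1) =
      (mextDeriv (ζ.typeComponent p Q)).typeComponent p (Q + 1) := by
    conv_lhs => rw [← sum_antidiagonal_typeComponent_holds ζ, mextDeriv_sum _ _ hsm,
      MForm.typeComponent_sum]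
    rw [Finset.sum_eq_single (p, Q)]
    · intro pq hpq hne
      by_cases hlt : pq.1 < p
      · rw [hF pq.1 pq.2 hlt, mextDeriv_zero, MForm.typeComponent_zero]
      · have hpq' := Finset.HasAntidiagonal.mem_antidiagonal.1 hpq
        refine IsOfType.typeComponent_mextDeriv_eq_zero (hsm pq hpq)
          (isOfType_typeComponent_holds hpq' ζ) ?_ ?_
        · intro h
          simp only [Prod.mk.injEq] at h
          omega
        · intro h
          simp only [Prod.mk.injEq] at h
          apply hne
          have h1 : pq.1 = p := by omega
          have h2 : pq.2 = Q := by omega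
          exact Prod.ext h1 h2
    · intro h
      exact absurd (Finset.HasAntidiagonal.mem_antidiagonal.2 hpQ) h
  rw [← key, hd, MForm.typeComponent_zero]

variable [FiniteDimensional ℂ E] [T2Space M] [CompactSpace M] [IsKaehlerManifold E M]

/-- **The `∂∂̄`-lemma for `∂`-exact forms** (conjugate of `ddbar_of_dolbeaultBar`): on a compact
Kähler manifold, if `a ∈ A^{p,q+1}` is smooth and `∂a` is `d`-closed, then `∂a = ∂̄∂b` for a smooth
`b` of type `(p, q)`. [cite: VoisinHodgeI2002, Prop. 6.17] -/
theorem exists_dolbeault_eq_dolbeaultBar_dolbeault {p q k : ℕ} {a : MForm 𝓘(ℝ, E) M ℂ (k + 1)}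
    (ha : IsSmoothForm a) (ht : IsOfType p (q + 1) a) (hz : mextDeriv (dolbeault a) = 0) :
    ∃ b : MForm 𝓘(ℝ, E) M ℂ k, IsSmoothForm b ∧ IsOfType p q b ∧
      dolbeault a = dolbeaultBar (dolbeault b) := by
  have hθs : IsSmoothForm a.conj := isSmoothForm_conj ha
  have hθt : IsOfType (q + 1) p a.conj := ht.conj
  have hz' : mextDeriv (dolbeaultBar a.conj) = 0 := by
    rw [dolbeaultBar_conj', mextDeriv_conj_holds, hz, MForm.conj_zero]
  obtain ⟨β, hβs, hβt, hβ⟩ := ddbar_of_dolbeaultBar hθs hθt hz'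
  refine ⟨β.conj, isSmoothForm_conj hβs, hβt.conj, ?_⟩
  have h1 : dolbeault a = (dolbeaultBar a.conj).conj := by
    rw [dolbeaultBar_conj', MForm.conj_conj]
  rw [h1, hβ, dolbeault_conj', dolbeaultBar_conj']

/-- **One step down the Hodge filtration** (the strictness of `d`, Voisin I Prop. 7.5 / the
`∂∂̄`-lemma Prop. 6.17): a smooth closed `ζ ∈ F^p A^{k+1}` with `p + (q+1) = k + 1` is, up to the
exact form `db`, the sum of a CLOSED form `η = ζ^{p,q+1} + ∂̄b` of pure type `(p, q+1)` and a smooth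
closed `ζ₁ ∈ F^{p+1} A^{k+1}`. Here `b ∈ A^{p,q}` solves `∂ ζ^{p,q+1} = ∂̄∂ b`.
[cite: VoisinHodgeI2002, Prop. 6.17 and Prop. 7.5] -/
theorem exists_hodgeFiltration_step {k p q : ℕ} (hpq : p + (q + 1) = k + 1)
    {ζ : MForm 𝓘(ℝ, E) M ℂ (k + 1)} (hζ : IsSmoothForm ζ) (hd : mextDeriv ζ = 0)
    (hF : ∀ P Q' : ℕ, P < p → ζ.typeComponent P Q' = 0) :
    ∃ (η ζ₁ : MForm 𝓘(ℝ, E) M ℂ (k + 1)) (b : MForm 𝓘(ℝ, E) M ℂ k),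
      IsSmoothForm η ∧ mextDeriv η = 0 ∧ IsOfType p (q + 1) η ∧
      IsSmoothForm ζ₁ ∧ mextDeriv ζ₁ = 0 ∧ (∀ P Q' : ℕ, P < p + 1 → ζ₁.typeComponent P Q' = 0) ∧
      IsSmoothForm b ∧ ζ + mextDeriv b = η + ζ₁ := by
  set a := ζ.typeComponent p (q + 1) with ha_def
  have hat : IsOfType p (q + 1) a := isOfType_typeComponent_holds hpq ζ
  have has : IsSmoothForm a := hζ.typeComponent p (q + 1)
  have hdbar : dolbeaultBar a = 0 := dolbeaultBar_typeComponent_eq_zero hpq hζ hd hF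
  have hda : mextDeriv a = dolbeault a := by
    rw [mextDeriv_eq_dolbeault_add_dolbeaultBar_holds has, hdbar, add_zero]
  have hz : mextDeriv (dolbeault a) = 0 := by rw [← hda, has.mextDeriv_mextDeriv]
  obtain ⟨b, hbs, hbt, hb⟩ := exists_dolbeault_eq_dolbeaultBar_dolbeault has hat hz
  have hdbs : IsSmoothForm (dolbeault b) := hbs.dolbeault
  have hdbbs : IsSmoothForm (dolbeaultBar b) := hbs.dolbeaultBar
  refine ⟨a + dolbeaultBar b, ζ - a + dolbeault b, b, has.add hdbbs, ?_, ?_,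
    (hζ.sub' has).add hdbs, ?_, ?_, hbs, ?_⟩
  rotate_right
  · rw [mextDeriv_eq_dolbeault_add_dolbeaultBar_holds hbs]
    abel
  · -- `dη = ∂a + ∂∂̄b + ∂̄∂̄b = ∂̄∂b + ∂∂̄b = 0`
    rw [mextDeriv_add has hdbbs, hda, hb, mextDeriv_eq_dolbeault_add_dolbeaultBar_holds hdbbs,
      dolbeaultBar_dolbeaultBar_holds hbs, add_zero, add_comm (dolbeaultBar (dolbeault b))]
    exact dolbeault_dolbeaultBar_add_dolbeaultBar_dolbeault_holds hbs
  · exact hat.add (IsOfType.dolbeaultBar_holds hbt)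
  · -- `dζ₁ = dζ - da + d∂b = -∂̄∂b + (∂∂b + ∂̄∂b) = 0`
    rw [mextDeriv_add (hζ.sub' has) hdbs, mextDeriv_sub'' hζ has, hd, hda, hb,
      mextDeriv_eq_dolbeault_add_dolbeaultBar_holds hdbs, dolbeault_dolbeault_holds hbs]
    abel
  · intro P Q' hP
    rw [MForm.typeComponent_add, MForm.typeComponent_sub]
    have hdb0 : (dolbeault b).typeComponent P Q' = 0 :=
      IsOfType.typeComponent_of_ne_holds (IsOfType.dolbeault_holds hbt) (Or.inl (by omega))
    rw [hdb0, add_zero]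
    rcases Nat.lt_or_ge P p with hlt | hge
    · rw [hF P Q' hlt, IsOfType.typeComponent_of_ne_holds hat (Or.inl (by omega)), sub_zero]
    · obtain rfl : P = p := by omega
      by_cases hQ : Q' = q + 1
      · subst hQ
        rw [ha_def, typeComponent_typeComponent_self_holds, sub_self]
      · have hne : P + Q' ≠ k + 1 := by omega
        rw [MForm.typeComponent_of_ne hne, MForm.typeComponent_of_ne hne, sub_zero]

omit [IsManifold 𝓘(ℂ, E) ω M] [IsManifold 𝓘(ℝ, E) ∞ M] [FiniteDimensional ℂ E] [T2Space M]
  [CompactSpace M] [IsKaehlerManifold E M] in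
/-- The class of a closed form of pure type `(p, q)` lies in `H^{p,q}`. [cite: VoisinHodgeI2002, §6.1] -/
theorem mk_mem_hodgePQ_of_isOfType {k p q : ℕ} {η : MForm 𝓘(ℝ, E) M ℂ k}
    (hη : η ∈ cclosedSmoothForms E M k) (ht : IsOfType p q η) :
    complexDeRhamCohomology.mk E M k ⟨η, hη⟩ ∈ hodgePQ E M k p q :=
  Submodule.subset_span ⟨⟨η, hη⟩, ht, rfl⟩

/-- **Closed forms of `F^p A^k` have classes in `F^p H^k = ⨆_{P ≥ p} H^{P,Q}`** on a compact Kähler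
manifold (Voisin I, Prop. 7.5: `F^p H^k` is the set of classes representable by a closed form of
`F^p A^k`; here the inclusion needed by the route, proved by descending `p` with the
`∂∂̄`-lemma, `exists_hodgeFiltration_step`). [cite: VoisinHodgeI2002, Prop. 7.5 and Prop. 6.17] -/
theorem mk_mem_iSup_hodgePQ_of_typeComponent_eq_zero {k : ℕ} (p : ℕ) {ζ : MForm 𝓘(ℝ, E) M ℂ k}
    (hζ : ζ ∈ cclosedSmoothForms E M k) (hF : ∀ P Q : ℕ, P < p → ζ.typeComponent P Q = 0) :
    complexDeRhamCohomology.mk E M k ⟨ζ, hζ⟩ ∈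
      ⨆ (P : ℕ) (Q : ℕ) (_ : P + Q = k) (_ : p ≤ P), hodgePQ E M k P Q := by
  -- induction on `d = k + 1 - p`
  suffices H : ∀ (d p : ℕ), p + d = k + 1 → ∀ {ζ : MForm 𝓘(ℝ, E) M ℂ k}
      (hζ : ζ ∈ cclosedSmoothForms E M k), (∀ P Q : ℕ, P < p → ζ.typeComponent P Q = 0) →
      complexDeRhamCohomology.mk E M k ⟨ζ, hζ⟩ ∈
        ⨆ (P : ℕ) (Q : ℕ) (_ : P + Q = k) (_ : p ≤ P), hodgePQ E M k P Q by
    rcases Nat.lt_or_ge k p with hkp | hkp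
    · have h0 : ζ = 0 := eq_zero_of_typeComponent_eq_zero_of_lt hkp hF
      have h0' : (⟨ζ, hζ⟩ : cclosedSmoothForms E M k) = 0 := Subtype.ext h0
      rw [h0', map_zero]
      exact Submodule.zero_mem _
    · exact H (k + 1 - p) p (by omega) hζ hF
  intro d
  induction d with
  | zero =>
    intro p hp ζ hζ hF
    have h0 : ζ = 0 := eq_zero_of_typeComponent_eq_zero_of_lt (by omega) hF
    have h0' : (⟨ζ, hζ⟩ : cclosedSmoothForms E M k) = 0 := Subtype.ext h0
    rw [h0', map_zero]
    exact Submodule.zero_mem _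
  | succ d ih =>
    intro p hp ζ hζ hF
    have hζs : IsSmoothForm ζ := ((mem_cclosedSmoothForms_iff ζ).1 hζ).1
    have hd : mextDeriv ζ = 0 := ((mem_cclosedSmoothForms_iff ζ).1 hζ).2
    -- membership of a piece in the filtration
    have hle : ∀ P Q : ℕ, P + Q = k → p ≤ P → hodgePQ E M k P Q ≤
        ⨆ (P : ℕ) (Q : ℕ) (_ : P + Q = k) (_ : p ≤ P), hodgePQ E M k P Q := by
      intro P Q hPQ hpP y hy
      exact Submodule.mem_iSup_of_mem P (Submodule.mem_iSup_of_mem Q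
        (Submodule.mem_iSup_of_mem hPQ (Submodule.mem_iSup_of_mem hpP hy)))
    by_cases hpk : p = k
    · -- edge: `ζ` is a closed form of type `(k, 0)`
      subst hpk
      exact hle p 0 (Nat.add_zero p) le_rfl
        (mk_mem_hodgePQ_of_isOfType hζ (isOfType_zero_of_typeComponent_eq_zero hF))
    · -- step: `k = k' + 1`, `p + (q + 1) = k' + 1`
      obtain ⟨k', rfl⟩ : ∃ k', k = k' + 1 := ⟨k - 1, by omega⟩
      obtain ⟨q, hq⟩ : ∃ q, p + (q + 1) = k' + 1 := ⟨k' - p, by omega⟩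
      obtain ⟨η, ζ₁, b, hηs, hηd, hηt, hζ₁s, hζ₁d, hζ₁F, hbs, hsum⟩ :=
        exists_hodgeFiltration_step hq hζs hd hF
      have hηc : η ∈ cclosedSmoothForms E M (k' + 1) := mem_cclosedSmoothForms hηs hηd
      have hζ₁c : ζ₁ ∈ cclosedSmoothForms E M (k' + 1) := mem_cclosedSmoothForms hζ₁s hζ₁d
      -- `[ζ] = [η] + [ζ₁]`
      have hcl : complexDeRhamCohomology.mk E M (k' + 1) ⟨ζ, hζ⟩ =
          complexDeRhamCohomology.mk E M (k' + 1) ⟨η, hηc⟩ +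
            complexDeRhamCohomology.mk E M (k' + 1) ⟨ζ₁, hζ₁c⟩ := by
        rw [← map_add, complexDeRhamCohomology.mk_eq_mk_iff]
        have he : (ζ : MForm 𝓘(ℝ, E) M ℂ (k' + 1)) - (η + ζ₁) = -mextDeriv b := by
          rw [← hsum]; abel
        change (ζ : MForm 𝓘(ℝ, E) M ℂ (k' + 1)) - (η + ζ₁) ∈ cexactSmoothForms E M (k' + 1)
        rw [he]
        exact Submodule.neg_mem _ (Submodule.subset_span ⟨b, (mem_csmoothForms_iff b).2 hbs, rfl⟩)
      rw [hcl]
      refine Submodule.add_mem _ (hle p (q + 1) hq le_rfl (mk_mem_hodgePQ_of_isOfType hηc hηt)) ?_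
      have ih' := ih (p + 1) (by omega) hζ₁c hζ₁F
      have hmono : (⨆ (P : ℕ) (Q : ℕ) (_ : P + Q = k' + 1) (_ : p + 1 ≤ P),
          hodgePQ E M (k' + 1) P Q) ≤
          ⨆ (P : ℕ) (Q : ℕ) (_ : P + Q = k' + 1) (_ : p ≤ P), hodgePQ E M (k' + 1) P Q :=
        iSup_le fun P ↦ iSup_le fun Q ↦ iSup_le fun hPQ ↦ iSup_le fun hpP ↦
          hle P Q hPQ (by omega)
      exact hmono ih'

end Strictness

/-! ### Pointwise types: the symbol forms are of type `(p, 0)` on their open set -/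

section PointwiseTypes

open Literature.Analysis.Complex

variable {E : Type*} [NormedAddCommGroup E] [NormedSpace ℂ E]
  {M : Type*} [TopologicalSpace M] [ChartedSpace E M] {k : ℕ}

/-- The type projections are pointwise: `(α^{p,q})_x = (α_x)^{p,q}`. [cite: VoisinHodgeI2002, §2.3.1] -/
theorem typeComponent_apply_eq_typeProjAt (p q : ℕ) (α : MForm 𝓘(ℝ, E) M ℂ k) (x : M) :
    α.typeComponent p q x = typeProjAt (E := E) p q (α x) := by
  unfold typeProjAt MForm.typeComponent MForm.weightComponent
  split_ifs <;> rfl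

/-- The type components vanish where the form vanishes. [folklore] -/
theorem typeComponent_apply_of_apply_eq_zero (p q : ℕ) {α : MForm 𝓘(ℝ, E) M ℂ k} {x : M}
    (h : α x = 0) : α.typeComponent p q x = 0 := by
  rw [typeComponent_apply_eq_typeProjAt, h, typeProjAt_zero]

/-- The type components agree where the forms agree. [folklore] -/
theorem typeComponent_congr_apply' (p q : ℕ) {α β : MForm 𝓘(ℝ, E) M ℂ k} {x : M}
    (h : α x = β x) : α.typeComponent p q x = β.typeComponent p q x := by
  rw [typeComponent_apply_eq_typeProjAt, typeComponent_apply_eq_typeProjAt, h]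

/-- Type components commute with restriction to a subset. [folklore] -/
theorem typeComponent_restr (p q : ℕ) (α : MForm 𝓘(ℝ, E) M ℂ k) (W : Set M) :
    (α.restr W).typeComponent p q = (α.typeComponent p q).restr W := by
  funext x
  by_cases hx : x ∈ W
  · rw [MForm.restr_apply_of_mem _ hx]
    exact typeComponent_congr_apply' p q (MForm.restr_apply_of_mem _ hx)
  · rw [MForm.restr_apply_of_notMem _ hx]
    exact typeComponent_apply_of_apply_eq_zero p q (MForm.restr_apply_of_notMem _ hx)
/-- Type components commute with real scalars. [folklore] -/
theorem typeComponent_real_smul (p q : ℕ) (r : ℝ) (α : MForm 𝓘(ℝ, E) M ℂ k) :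
    (r • α).typeComponent p q = r • α.typeComponent p q := by
  rw [← Complex.coe_smul, MForm.typeComponent_smul, Complex.coe_smul]

variable [IsManifold 𝓘(ℝ, E) ∞ M]

/-- **The differential of a holomorphic function is of type `(1,0)`** at the points of its open set
of holomorphy (its real differential is `ℂ`-linear). [cite: VoisinHodgeI2002, §2.3.3 Lemma 2.29] -/
theorem isOfTypeAt_mextDeriv_ofFun {V : Set M} (hV : IsOpen V) {f : M → ℂ}
    (hf : MDifferentiableOn 𝓘(ℂ, E) 𝓘(ℂ, ℂ) f V) {x : M} (hx : x ∈ V) :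
    IsOfTypeAt (E := E) 1 0 (mextDeriv (MForm.ofFun 𝓘(ℝ, E) f) x) := by
  refine ⟨rfl, fun θ v ↦ ?_⟩
  have hdC : DifferentiableAt ℂ (f ∘ (extChartAt 𝓘(ℝ, E) x).symm) (extChartAt 𝓘(ℝ, E) x x) :=
    differentiableAt_comp_extChartAt_symm_of_mdifferentiableAt
      ((hf x hx).mdifferentiableAt (hV.mem_nhds hx))
  have h := (mextDeriv_ofFun_rotate_iff f x).2 (fun θ w ↦ by
    rw [hdC.fderiv_restrictScalars ℝ, ContinuousLinearMap.coe_restrictScalars', map_smul,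
      smul_eq_mul]) θ v
  have e1 : (((1 : ℕ) : ℤ) - ((0 : ℕ) : ℤ) : ℤ) = 1 := by norm_num
  rw [e1, Int.cast_one, one_mul]
  exact h

/-- `dlog f` is of type `(1,0)` at the points where `f` is a holomorphic unit. [cite: EsnaultViehweg1988DB, §7] -/
theorem isOfTypeAt_dlog {V : Set M} (hV : IsOpen V) {f : M → ℂ} (hf : IsHolUnitOn E V f) {x : M}
    (hx : x ∈ V) : IsOfTypeAt (E := E) 1 0 (dlog E f x) := by
  rw [dlog_apply]
  exact (isOfTypeAt_mextDeriv_ofFun hV hf.mdifferentiableOn hx).smul _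

/-- `dlog f₁ ∧ ⋯ ∧ dlog f_p` is of type `(p, 0)` at the points of an open set on which all `fᵢ` are
holomorphic units (types add under `∧`). [cite: VoisinHodgeI2002, §2.3.1] -/
theorem isOfTypeAt_dlogWedge {V : Set M} (hV : IsOpen V) {x : M} (hx : x ∈ V) (p : ℕ) :
    ∀ (t : Fin p → M → ℂ), IsGoodTuple E V t → IsOfTypeAt (E := E) p 0 (dlogWedge E p t x) := by
  induction p with
  | zero =>
    intro t _
    rw [dlogWedge_zero]
    refine ⟨rfl, fun θ v ↦ ?_⟩
    have hv : (fun i ↦ Complex.exp (θ * Complex.I) • v i) = v := funext fun i ↦ Fin.elim0 i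
    rw [hv]
    simp
  | succ p ih =>
    intro t ht
    rw [dlogWedge_succ, MForm.wedge_apply]
    exact (ih (fun i ↦ t (Fin.castSucc i)) fun i ↦ ht _).wedge
      (isOfTypeAt_dlog hV (ht (Fin.last p)) hx)

/-- **The symbol form of a chain of good tuples on `W` is of type `(p, 0)` at the points of `W`.**
[cite: GreenGriffiths2005TangentSpace, §6.3 (6.37)] -/
theorem isOfTypeAt_symbolForm {W : Set M} (hW : IsOpen W) {p : ℕ} {s : (Fin p → M → ℂ) →₀ ℤ}
    (hs : ∀ t ∈ s.support, IsGoodTuple E W t) {x : M} (hx : x ∈ W) :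
    IsOfTypeAt (E := E) p 0 (symbolForm E p s x) := by
  unfold symbolForm
  rw [Finsupp.sum, Finset.sum_apply]
  refine isOfTypeAt_sum (Nat.add_zero p) _ fun t ht ↦ ?_
  rw [Pi.smul_apply, ← Int.cast_smul_eq_zsmul ℂ]
  exact (isOfTypeAt_dlogWedge hW hx p t (hs t ht)).smul _

/-- Hence the type components `(p', q')`, `p' < p`, of a symbol form vanish at the points of `W`.
[cite: VoisinHodgeI2002, §2.3.1] -/
theorem typeComponent_symbolForm_apply_eq_zero {W : Set M} (hW : IsOpen W) {p : ℕ}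
    {s : (Fin p → M → ℂ) →₀ ℤ} (hs : ∀ t ∈ s.support, IsGoodTuple E W t) {x : M} (hx : x ∈ W)
    {P Q : ℕ} (hP : P < p) : (symbolForm E p s).typeComponent P Q x = 0 := by
  rw [typeComponent_apply_eq_typeProjAt]
  exact (isOfTypeAt_symbolForm hW hs hx).typeProjAt_of_ne (Or.inl (by omega))

end PointwiseTypes

/-- Registered sub-goal of helper 1/3: `dlog f` of a holomorphic unit `f` on `ℂ` is of type `(1,0)`
at every point (instance of `isOfTypeAt_dlog`). [cite: EsnaultViehweg1988DB, §7] -/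
theorem stub_symbolClassesHodgeType_dlogType : ∀ (f : ℂ → ℂ) (x : ℂ), IsHolUnitOn ℂ Set.univ f → Literature.Analysis.Complex.IsOfTypeAt (E := ℂ) 1 0 (dlog ℂ f x) :=
  fun _ _ hf ↦ isOfTypeAt_dlog isOpen_univ hf (Set.mem_univ _)

end Summit.HodgeConjecture.HodgeConjecture.Theorems.MilnorKExponentialNash

end
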